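import Summits.CriticalPhenomena.Ising3DConformalLimit.Theorems.FKParityRobustnessFKFourConnectivityDefs
import Summits.CriticalPhenomena.Ising3DConformalLimit.Theorems.FKParityRobustnessFKFourConnectivityHoleDictionary
import Literature.Probability.LatticeModels.RandomClusterExploredWiring
import Literature.Probability.LatticeModels.RandomClusterDomainMarkovFree
import Literature.Probability.LatticeModels.RandomClusterPinnedComparison
import Literature.Probability.LatticeModels.RandomClusterRegionToAnnulus
import Literature.Probability.LatticeModels.FKIsingRSWProofs
import Literature.Probability.Percolation.PercolationEvents

/-!
# Crux `FKFourConnectivity` (stmt-CriticalPhenomena-11254), line `cluster-hole-opacity`: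
# the peel identity (stub `stub_peel`)

For a finite graph `G`, `0 ≤ p < 1`, `q > 0`, `y ≠ y'`:
`φ(x ↔ x', y ↔ y', x ↮ y) = ∫ 1{x ↔ x'}(ω) · φ(y ↔ y' ∩ hole C_ω(x)) / φ(hole C_ω(x)) dφ(ω)`,
`φ` the free random-cluster measure, `C_ω(x)` the open cluster of `x` (PEELING the cluster of `x`).
Proof (exact identity between finite sums, `rcMeasure_real_apply` / `integral_rcMeasure`): regroup
the edge sets `ω ⊆ E(G)` along the peeling map `ω ↦ ζ(ω) =` the open edges touching `C_ω(x)`; its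
fibres are the cylinders `{ω ∖ U = ζ}`, `U =` the edges of `G` not touching `C = C_ζ(x)`
(`filter_touch_eq_iff`), on which `C_ω(x) = C` and an open `y – y'` path from `y ∉ C` only uses
edges of `U`.  The explored-wiring domain Markov property (Grimmett 2006, Lemma (4.13);
`rcMeasure_real_inter_cylinder_eq_mul_fromEdgeSet_of_reachable` with `B = {x}`, `W = C`; wiring the
`⟨U⟩`-isolated set `C` is irrelevant, `rcMeasure_real_union_isolated`) and the closed-outside
domain Markov property (Grimmett 2006, Thm. (3.1)(a); `rcMeasure_real_inter_cylinder_empty_eq_mul_fromEdgeSet`)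
evaluate both fibre sums as `1[x' ∈ C] · φ(cylinder) · φ^∅_{⟨U⟩}(y ↔ y')`.
-/

noncomputable section

open MeasureTheory Finset
open Literature.Probability.LatticeModels Literature.Probability.Percolation

namespace Summit.CriticalPhenomena.Ising3DConformalLimit.Cruxes.FKFourConnectivity.ClusterHoleOpacity

open scoped Classical

section Helpers

variable {V : Type*}

/-- An open edge with one endpoint in the open cluster of `x` has both endpoints in it.
[folklore] -/
theorem mem_openCluster_of_mem_edge {ω : BondConfig V} {x : V} {e : Sym2 V} (he : e ∈ ω)
    (hd : ¬e.IsDiag) {u : V} (hu : u ∈ openCluster ω x) (hue : u ∈ e) {v : V} (hve : v ∈ e) :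
    v ∈ openCluster ω x := by
  induction e using Sym2.ind with
  | h a b =>
    have hab : (openGraph ω).Adj a b :=
      (openGraph_adj ω a b).2 ⟨he, fun h => hd (Sym2.mk_isDiag_iff.2 h)⟩
    have key : a ∈ openCluster ω x ∧ b ∈ openCluster ω x := by
      rcases Sym2.mem_iff.1 hue with rfl | rfl
      · exact ⟨hu, SimpleGraph.Reachable.trans hu hab.reachable⟩
      · exact ⟨SimpleGraph.Reachable.trans hu hab.symm.reachable, hu⟩
    rcases Sym2.mem_iff.1 hve with rfl | rfl
    exacts [key.1, key.2]

/-- The open cluster of `x` is determined by the open edges touching it: if `ζ ⊆ ω` and every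
edge of `ω` with an endpoint in the `ζ`-cluster of `x` already lies in `ζ`, the two clusters of
`x` agree. [folklore] -/
theorem openCluster_eq_of_subset {ζ ω : BondConfig V} {x : V} (hsub : ζ ⊆ ω)
    (h : ∀ e ∈ ω, ∀ u ∈ openCluster ζ x, u ∈ e → e ∈ ζ) :
    openCluster ω x = openCluster ζ x := by
  refine Set.Subset.antisymm (fun v hv => ?_) fun v hv => hv.mono (openGraph_mono hsub)
  refine mem_of_reachable_of_closed (H := openGraph ω) (C := openCluster ζ x) ?_
    (mem_openCluster_self ζ x) hv
  intro u w hu huw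
  rw [openGraph_adj] at huw
  have hζ : s(u, w) ∈ ζ := h _ huw.1 u hu (Sym2.mem_mk_left u w)
  exact SimpleGraph.Reachable.trans hu ((openGraph_adj ζ u w).2 ⟨hζ, huw.2⟩).reachable

/-- An open path from a vertex outside the open cluster `C` of `x` never uses an edge touching
`C`: if every open edge off `T` touches `C`, the path is `ω ∩ T`-open. [folklore] -/
theorem reachable_inter_of_not_mem_openCluster {ω T : BondConfig V} {x y y' : V}
    (hT : ∀ e ∈ ω, e ∉ T → ∃ v ∈ openCluster ω x, v ∈ e) (hy : y ∉ openCluster ω x)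
    (h : (openGraph ω).Reachable y y') : (openGraph (ω ∩ T)).Reachable y y' := by
  refine mem_of_reachable_of_closed (H := openGraph ω)
    (C := {v | (openGraph (ω ∩ T)).Reachable y v}) ?_ (SimpleGraph.Reachable.refl y) h
  intro u w hu huw
  rw [openGraph_adj] at huw
  by_cases hsT : s(u, w) ∈ T
  · exact SimpleGraph.Reachable.trans hu
      ((openGraph_adj (ω ∩ T) u w).2 ⟨Set.mem_inter huw.1 hsT, huw.2⟩).reachable
  · exfalso
    obtain ⟨c, hc, hce⟩ := hT _ huw.1 hsT
    have hyu : (openGraph ω).Reachable y u :=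
      SimpleGraph.Reachable.mono (openGraph_mono Set.inter_subset_left) hu
    have huw' : (openGraph ω).Reachable u w := ((openGraph_adj ω u w).2 huw).reachable
    refine hy ?_
    rcases Sym2.mem_iff.1 hce with rfl | rfl
    · exact SimpleGraph.Reachable.trans hc hyu.symm
    · exact SimpleGraph.Reachable.trans hc (hyu.trans huw').symm

/-- Under the hole of `C` a vertex of `C` is isolated: it is joined to no other vertex.
[folklore] -/
theorem not_reachable_of_mem_hole {ω : BondConfig V} {C : Set V} (hω : ω ∈ hole C) {y y' : V}
    (hy : y ∈ C) (hne : y ≠ y') : ¬(openGraph ω).Reachable y y' := by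
  rintro ⟨w⟩
  cases w with
  | nil => exact hne rfl
  | cons hadj _ =>
    rw [openGraph_adj] at hadj
    exact hω _ hadj.1 y hy (Sym2.mem_mk_left _ _)

/-- On the cylinder `{ω ∖ U = ζ}`, where `U` is the set of edges of `G` not touching the
`ζ`-cluster `C` of `x`, the open cluster of `x` is `C`. [folklore] -/
theorem openCluster_eq_of_cyl {x : V} {ω ζ U E : Finset (Sym2 V)} {C : Set V}
    (hU : ∀ e, e ∈ U ↔ e ∈ E ∧ ∀ v ∈ C, v ∉ e) (hC : openCluster (↑ζ : BondConfig V) x = C)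
    (h : (↑ω : Set (Sym2 V)) ∩ (↑U)ᶜ = ↑ζ) : openCluster (↑ω : BondConfig V) x = C := by
  have hmem : ∀ e, e ∈ ζ ↔ e ∈ ω ∧ e ∉ U := fun e => by
    simpa only [Set.mem_inter_iff, Set.mem_compl_iff, Finset.mem_coe] using (Set.ext_iff.1 h e).symm
  rw [← hC]
  refine openCluster_eq_of_subset (fun e he => ?_) fun e he u hu hue => ?_
  · exact Finset.mem_coe.2 ((hmem e).1 (Finset.mem_coe.1 he)).1
  · refine Finset.mem_coe.2 ((hmem e).2 ⟨Finset.mem_coe.1 he, fun heU => ((hU e).1 heU).2 u ?_ hue⟩)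
    rwa [← hC]

/-- **The fibres of the peeling map are cylinders.** For `ω ⊆ E`, the open edges of `ω` touching
the open cluster of `x` form the set `ζ` iff `ω ∖ U = ζ`, where `U` is the set of edges of `E`
not touching the `ζ`-cluster `C` of `x`. [folklore] -/
theorem filter_touch_eq_iff {x : V} {ω ζ U E Φω : Finset (Sym2 V)} {C : Set V} (hω : ω ⊆ E)
    (hU : ∀ e, e ∈ U ↔ e ∈ E ∧ ∀ v ∈ C, v ∉ e) (hC : openCluster (↑ζ : BondConfig V) x = C)
    (hΦ : ∀ e, e ∈ Φω ↔ e ∈ ω ∧ ∃ v ∈ openCluster (↑ω : BondConfig V) x, v ∈ e) :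
    Φω = ζ ↔ (↑ω : Set (Sym2 V)) ∩ (↑U)ᶜ = ↑ζ := by
  -- an edge of `ω` touches `C` iff it lies off `U`
  have hiffU : ∀ e ∈ ω, ((∃ v ∈ C, v ∈ e) ↔ e ∉ U) := fun e he => by
    constructor
    · rintro ⟨v, hv, hve⟩ heU
      exact ((hU e).1 heU).2 v hv hve
    · intro heU
      by_contra hne
      push Not at hne
      exact heU ((hU e).2 ⟨hω he, hne⟩)
  constructor
  · intro h
    have hmem : ∀ e, e ∈ ζ ↔ e ∈ ω ∧ ∃ v ∈ openCluster (↑ω : BondConfig V) x, v ∈ e :=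
      fun e => by rw [← h, hΦ]
    have hsub : (↑ζ : BondConfig V) ⊆ ↑ω := Finset.coe_subset.2 fun e he => ((hmem e).1 he).1
    have hCω : openCluster (↑ω : BondConfig V) x = C := by
      rw [← hC]
      refine openCluster_eq_of_subset hsub fun e he u hu hue => Finset.mem_coe.2 ?_
      exact (hmem e).2 ⟨Finset.mem_coe.1 he, u, hu.mono (openGraph_mono hsub), hue⟩
    ext e
    simp only [Set.mem_inter_iff, Set.mem_compl_iff, Finset.mem_coe]
    rw [hmem, hCω]
    exact and_congr_right fun he => (hiffU e he).symm
  · intro h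
    have hmem : ∀ e, e ∈ ζ ↔ e ∈ ω ∧ e ∉ U := fun e => by
      simpa only [Set.mem_inter_iff, Set.mem_compl_iff, Finset.mem_coe] using
        (Set.ext_iff.1 h e).symm
    have hCω := openCluster_eq_of_cyl hU hC h
    ext e
    rw [hΦ, hmem, hCω]
    exact and_congr_right fun he => hiffU e he

variable [Fintype V] [DecidableEq V]

/-- Wiring a single vertex is no wiring: `φ^{{x}}_{G,p,q} = φ^∅_{G,p,q}`. [folklore] -/
theorem rcMeasure_singleton (G : SimpleGraph V) [DecidableRel G.Adj] (p q : ℝ) (x : V) :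
    rcMeasure G p q ({x} : Set V) = rcMeasure G p q ∅ := by
  have hw : rcWeight G p q ({x} : Set V) = rcWeight G p q ∅ := by
    funext ω
    simp only [rcWeight, clusterCount, wired_singleton_eq_wired_empty]
  have hZ : rcPartitionFunction G p q ({x} : Set V) = rcPartitionFunction G p q ∅ := by
    simp only [rcPartitionFunction, hw]
  simp only [rcMeasure, hw, hZ]

/-- Wiring a set of vertices none of which meets an edge of the graph does not change the
random-cluster measure (`rcMeasure_real_union_isolated`). [folklore] -/
theorem rcMeasure_real_wired_eq_of_isolated (H : SimpleGraph V) [DecidableRel H.Adj] {p q : ℝ}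
    (hp : p ∈ Set.Icc (0 : ℝ) 1) (hq : 0 < q) {W : Set V} (hW : ∀ v ∈ W, ∀ w, ¬H.Adj v w)
    (A : Set (BondConfig V)) :
    (rcMeasure H p q W).real A = (rcMeasure H p q ∅).real A := by
  have h := rcMeasure_real_union_isolated H hp hq ∅ W.toFinite.toFinset
    (fun v hv => hW v ((Set.Finite.mem_toFinset _).1 hv)) A
  rwa [Set.Finite.coe_toFinset, Set.empty_union] at h

/-- **Conditioning on a hole.** For `p < 1`, conditioning the free random-cluster measure on the
hole of `K` gives the free random-cluster measure of the spanning graph of the edges `U` of `G`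
not touching `K` (closed-outside domain Markov property,
`rcMeasure_real_inter_cylinder_empty_eq_mul_fromEdgeSet`; the computation behind
`stub_holeDictionary`): `φ(S ∩ hole K) / φ(hole K) = φ^∅_{⟨U⟩}(S)` for every event `S`.
[folklore] -/
theorem real_inter_hole_div (G : SimpleGraph V) [DecidableRel G.Adj] {p q : ℝ}
    (hp : p ∈ Set.Ico (0 : ℝ) 1) (hq : 0 < q) (K : Set V) {U : Finset (Sym2 V)}
    (hU : ∀ e, e ∈ U ↔ e ∈ G.edgeFinset ∧ ∀ v ∈ K, v ∉ e) (S : Set (BondConfig V)) :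
    (rcMeasure G p q ∅).real (S ∩ hole K) / (rcMeasure G p q ∅).real (hole K) =
      (rcMeasure (SimpleGraph.fromEdgeSet (↑U : Set (Sym2 V))) p q ∅).real S := by
  have hp' : p ∈ Set.Icc (0 : ℝ) 1 := ⟨hp.1, hp.2.le⟩
  have hUE : U ⊆ G.edgeFinset := fun e he => ((hU e).1 he).1
  -- on the support, the hole of `K` is the cylinder "every edge off `U` is closed"
  have hsupp : ∀ ω : Finset (Sym2 V), ω ⊆ G.edgeFinset →
      ((↑ω : BondConfig V) ∈ hole K ↔
        (↑ω : BondConfig V) ∈ {ω : BondConfig V | ω ∩ (↑U : Set (Sym2 V))ᶜ = ∅}) := by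
    intro ω hω
    rw [Set.mem_setOf_eq, ← Set.sdiff_eq, Set.sdiff_eq_empty, Finset.coe_subset, mem_hole]
    constructor
    · intro h e he
      exact (hU e).2 ⟨hω he, h e (Finset.mem_coe.2 he)⟩
    · intro h e he v hv
      exact ((hU e).1 (h (Finset.mem_coe.1 he))).2 v hv
  -- on that cylinder `ω ∩ U = ω`
  have hev : S ∩ {ω : BondConfig V | ω ∩ (↑U : Set (Sym2 V))ᶜ = ∅} =
      {ω : BondConfig V | ω ∩ ↑U ∈ S} ∩ {ω : BondConfig V | ω ∩ (↑U : Set (Sym2 V))ᶜ = ∅} := by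
    ext ω
    simp only [Set.mem_inter_iff, Set.mem_setOf_eq]
    refine and_congr_left fun h2 => ?_
    have hωU : ω ∩ ↑U = ω := by
      rw [Set.inter_eq_left, ← Set.sdiff_eq_empty, Set.sdiff_eq]
      exact h2
    rw [hωU]
  have hnum : (rcMeasure G p q ∅).real (S ∩ hole K) = (rcMeasure G p q ∅).real
      ({ω : BondConfig V | ω ∩ ↑U ∈ S} ∩ {ω : BondConfig V | ω ∩ (↑U : Set (Sym2 V))ᶜ = ∅}) := by
    rw [← hev]
    exact rcMeasure_real_congr_support G hp' hq ∅ fun ω hω => and_congr_right' (hsupp ω hω)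
  have hden : (rcMeasure G p q ∅).real (hole K) =
      (rcMeasure G p q ∅).real {ω : BondConfig V | ω ∩ (↑U : Set (Sym2 V))ᶜ = ∅} :=
    rcMeasure_real_congr_support G hp' hq ∅ hsupp
  rw [hnum, hden, rcMeasure_real_inter_cylinder_empty_eq_mul_fromEdgeSet G hp' hq ∅ U hUE S,
    mul_div_cancel_left₀ _ (rcMeasure_real_offClosed_pos G hp hq ∅ U).ne']

/-- **The fibre identity of the peeling.** For `C = C_ζ(x)` and `U` the edges of `G` not touching
`C`, summed over the cylinder `{ω ⊆ E(G) | ω ∖ U = ζ}` the weights of `{x ↔ x', y ↔ y', x ↮ y}`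
and of `1{x ↔ x'} · φ(y ↔ y' ∩ hole C_ω(x)) / φ(hole C_ω(x))` agree: both are
`1[x' ∈ C] · φ(cylinder) · φ^∅_{⟨U⟩}(y ↔ y')` (explored-wiring domain Markov property with `{x}`
wired and `W = C`, Grimmett 2006 Lemma (4.13); un-wiring the `⟨U⟩`-isolated `C`;
`real_inter_hole_div`). [folklore] -/
theorem fibre_eq (G : SimpleGraph V) [DecidableRel G.Adj] {p q : ℝ} (hp : p ∈ Set.Ico (0 : ℝ) 1)
    (hq : 0 < q) (x x' y y' : V) (hyy' : y ≠ y') (ζ : Finset (Sym2 V)) {U : Finset (Sym2 V)}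
    {C : Set V} (hU : ∀ e, e ∈ U ↔ e ∈ G.edgeFinset ∧ ∀ v ∈ C, v ∉ e)
    (hCζ : openCluster (↑ζ : BondConfig V) x = C) :
    ∑ ω ∈ G.edgeFinset.powerset,
        (if (↑ω : Set (Sym2 V)) ∩ (↑U)ᶜ = ↑ζ then
          (if (↑ω : BondConfig V) ∈ openConn x x' ∩ openConn y y' ∩ (openConn x y)ᶜ then
            rcWeight G p q ∅ ω / rcPartitionFunction G p q ∅ else 0) else 0) =
      ∑ ω ∈ G.edgeFinset.powerset,
        (if (↑ω : Set (Sym2 V)) ∩ (↑U)ᶜ = ↑ζ then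
          rcWeight G p q ∅ ω / rcPartitionFunction G p q ∅ *
            (openConn x x').indicator
              (fun ω => (rcMeasure G p q ∅).real (openConn y y' ∩ hole (openCluster ω x)) /
                (rcMeasure G p q ∅).real (hole (openCluster ω x))) (↑ω : BondConfig V)
          else 0) := by
  have hp' : p ∈ Set.Icc (0 : ℝ) 1 := ⟨hp.1, hp.2.le⟩
  have hUE : U ⊆ G.edgeFinset := fun e he => ((hU e).1 he).1
  set cyl : Set (BondConfig V) := {ω | ω ∩ (↑U : Set (Sym2 V))ᶜ = ↑ζ} with hcyl
  -- the cluster of `x` seen from a configuration of the cylinder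
  have hxv : ∀ ω : Finset (Sym2 V), (↑ω : Set (Sym2 V)) ∩ (↑U)ᶜ = ↑ζ →
      ∀ v, ((↑ω : BondConfig V) ∈ openConn x v ↔ v ∈ C) := fun ω hc v => by
    rw [← openCluster_eq_of_cyl hU hCζ hc]
    rfl
  -- the middle factor: explored-wiring domain Markov property on the cylinder (`B = {x}`,
  -- `W = C`), or both sides vanish when the cylinder misses the support
  have hmid : (rcMeasure G p q ∅).real ({ω : BondConfig V | ω ∩ ↑U ∈ openConn y y'} ∩ cyl) =
      (rcMeasure G p q ∅).real cyl *
        (rcMeasure (SimpleGraph.fromEdgeSet (↑U : Set (Sym2 V))) p q ∅).real (openConn y y') := by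
    by_cases hval : ζ ⊆ G.edgeFinset \ U
    · have hζC : ∀ e ∈ ζ, ∀ v ∈ e, v ∈ C := by
        intro e he v hv
        obtain ⟨heE, heU⟩ := Finset.mem_sdiff.1 (hval he)
        obtain ⟨u, hu, hue⟩ : ∃ u ∈ C, u ∈ e := by
          by_contra h
          push Not at h
          exact heU ((hU e).2 ⟨heE, h⟩)
        rw [← hCζ] at hu ⊢
        exact mem_openCluster_of_mem_edge (Finset.mem_coe.2 he)
          (G.not_isDiag_of_mem_edgeSet (SimpleGraph.mem_edgeFinset.1 heE)) hu hue hv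
      have hW : ∀ v ∈ C, ∃ b ∈ ({x} : Set V),
          (SimpleGraph.fromEdgeSet (↑ζ : Set (Sym2 V))).Reachable v b := by
        intro v hv
        rw [← hCζ] at hv
        exact ⟨x, Set.mem_singleton x, SimpleGraph.Reachable.symm hv⟩
      have hxC : ({x} : Set V) ⊆ C :=
        Set.singleton_subset_iff.2 (hCζ ▸ mem_openCluster_self _ x)
      have hiso : ∀ v ∈ C, ∀ w, ¬(SimpleGraph.fromEdgeSet (↑U : Set (Sym2 V))).Adj v w := by
        intro v hv w hvw
        rw [SimpleGraph.fromEdgeSet_adj, Finset.mem_coe] at hvw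
        exact ((hU _).1 hvw.1).2 v hv (Sym2.mem_mk_left v w)
      rw [← rcMeasure_singleton G p q x,
        rcMeasure_real_inter_cylinder_eq_mul_fromEdgeSet_of_reachable G hp' hq U hUE hval hxC hζC
          hW _, rcMeasure_real_wired_eq_of_isolated _ hp' hq hiso]
    · have hz : ∀ S : Set (BondConfig V), (rcMeasure G p q ∅).real (S ∩ cyl) = 0 := by
        intro S
        rw [rcMeasure_real_congr_support G hp' hq ∅ (S' := ∅) fun ω hω => ?_, measureReal_empty]
        simp only [Set.mem_empty_iff_false, iff_false]
        rintro ⟨-, hc⟩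
        refine hval fun e he => ?_
        have hmem : e ∈ ω ∧ e ∉ U := by
          simpa only [Set.mem_inter_iff, Set.mem_compl_iff, Finset.mem_coe] using
            (Set.ext_iff.1 hc e).2 (Finset.mem_coe.2 he)
        exact Finset.mem_sdiff.2 ⟨hω hmem.1, hmem.2⟩
      have hz' : (rcMeasure G p q ∅).real cyl = 0 := by
        simpa only [Set.univ_inter] using hz Set.univ
      rw [hz, hz', zero_mul]
  calc
    _ = (if x' ∈ C then 1 else 0) * (rcMeasure G p q ∅).real
          ({ω : BondConfig V | ω ∩ ↑U ∈ openConn y y'} ∩ cyl) := by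
      -- left side, configuration by configuration on the cylinder
      rw [rcMeasure_real_apply G hp' hq ∅ ({ω : BondConfig V | ω ∩ ↑U ∈ openConn y y'} ∩ cyl),
        Finset.mul_sum]
      refine Finset.sum_congr rfl fun ω hω => ?_
      rw [Finset.mem_powerset] at hω
      by_cases hc : (↑ω : Set (Sym2 V)) ∩ (↑U)ᶜ = ↑ζ
      · have hCω : openCluster (↑ω : BondConfig V) x = C := openCluster_eq_of_cyl hU hCζ hc
        have hiff : (↑ω : BondConfig V) ∈ openConn x x' ∩ openConn y y' ∩ (openConn x y)ᶜ ↔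
            x' ∈ C ∧ (↑ω : BondConfig V) ∈ {ω : BondConfig V | ω ∩ ↑U ∈ openConn y y'} ∩ cyl := by
          constructor
          · rintro ⟨⟨hxx', hyy⟩, hxy⟩
            have hyC : y ∉ openCluster (↑ω : BondConfig V) x := fun h =>
              hxy ((hxv ω hc y).2 (hCω ▸ h))
            have hT : ∀ e ∈ (↑ω : BondConfig V), e ∉ (↑U : Set (Sym2 V)) →
                ∃ v ∈ openCluster (↑ω : BondConfig V) x, v ∈ e := by
              intro e he heU
              rw [hCω]
              by_contra hne
              push Not at hne
              exact heU (Finset.mem_coe.2 ((hU e).2 ⟨hω (Finset.mem_coe.1 he), hne⟩))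
            exact ⟨(hxv ω hc x').1 hxx', reachable_inter_of_not_mem_openCluster hT hyC hyy, hc⟩
          · rintro ⟨hx'C, hA, -⟩
            have hhole : (↑ω : BondConfig V) ∩ ↑U ∈ hole C := fun e he v hv =>
              ((hU e).1 (Finset.mem_coe.1 he.2)).2 v hv
            refine ⟨⟨(hxv ω hc x').2 hx'C,
              SimpleGraph.Reachable.mono (openGraph_mono Set.inter_subset_left) hA⟩, fun hxy => ?_⟩
            exact not_reachable_of_mem_hole hhole ((hxv ω hc y).1 hxy) hyy' hA
        rw [if_pos hc]
        by_cases hx' : x' ∈ C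
        · rw [if_pos hx', one_mul]
          exact if_congr (hiff.trans (and_iff_right hx')) rfl rfl
        · rw [if_neg hx', zero_mul]
          exact if_neg fun h => hx' (hiff.1 h).1
      · rw [if_neg hc, if_neg (show (↑ω : BondConfig V) ∉
          {ω : BondConfig V | ω ∩ ↑U ∈ openConn y y'} ∩ cyl from fun h => hc h.2), mul_zero]
    _ = (if x' ∈ C then 1 else 0) * ((rcMeasure G p q ∅).real (openConn y y' ∩ hole C) /
          (rcMeasure G p q ∅).real (hole C)) * (rcMeasure G p q ∅).real cyl := by
      rw [hmid, real_inter_hole_div G hp hq C hU]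
      ring
    _ = _ := by
      -- right side, configuration by configuration on the cylinder
      rw [rcMeasure_real_apply G hp' hq ∅ cyl, Finset.mul_sum]
      refine Finset.sum_congr rfl fun ω _ => ?_
      by_cases hc : (↑ω : Set (Sym2 V)) ∩ (↑U)ᶜ = ↑ζ
      · rw [if_pos hc, if_pos (show (↑ω : BondConfig V) ∈ cyl from hc), Set.indicator_apply,
          openCluster_eq_of_cyl hU hCζ hc]
        by_cases hx' : x' ∈ C
        · rw [if_pos ((hxv ω hc x').2 hx'), if_pos hx']
          ring
        · rw [if_neg (fun h => hx' ((hxv ω hc x').1 h)), if_neg hx']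
          ring
      · rw [if_neg hc, if_neg (show (↑ω : BondConfig V) ∉ cyl from hc), mul_zero]

end Helpers

/-- **Peel identity** (registered stub `stub_peel` of the line `cluster-hole-opacity`, crux
`FKFourConnectivity`, stmt-CriticalPhenomena-11254): the explored-cluster domain Markov property
of the free random-cluster measure of a finite graph, integrated.  For `0 ≤ p < 1`, `q > 0`,
`y ≠ y'`,
`φ(x ↔ x', y ↔ y', x ↮ y) = ∫ 1{x ↔ x'}(ω) · φ(y ↔ y' ∩ hole C_ω(x)) / φ(hole C_ω(x)) dφ(ω)`:
sum over the value `C` of the open cluster of `x` (and the open edges inside it); given these,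
the configuration off the edges touching `C` is `φ(· | hole C)` (Grimmett 2006, Thm. (3.1)(a) and
Lemma (4.13)); clusters `C ∋ y` contribute `0` to both sides (`x ↮ y` fails, resp. `y ≠ y'` is
isolated under `hole C`), and `φ(hole C) > 0` because `p < 1`. -/
theorem stub_peel :
    ∀ (V : Type) [Fintype V] [DecidableEq V] (G : SimpleGraph V) [DecidableRel G.Adj] (p q : ℝ),
      p ∈ Set.Ico (0 : ℝ) 1 → 0 < q → ∀ x x' y y' : V, y ≠ y' →
        (rcMeasure G p q ∅).real (openConn x x' ∩ openConn y y' ∩ (openConn x y)ᶜ) =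
          ∫ ω, (openConn x x').indicator
            (fun ω => (rcMeasure G p q ∅).real (openConn y y' ∩ hole (openCluster ω x)) /
              (rcMeasure G p q ∅).real (hole (openCluster ω x))) ω ∂(rcMeasure G p q ∅) := by
  intro V _ _ G _ p q hp hq x x' y y' hyy'
  have hp' : p ∈ Set.Icc (0 : ℝ) 1 := ⟨hp.1, hp.2.le⟩
  -- the peeling map: the open edges touching the open cluster of `x`
  set Φ : Finset (Sym2 V) → Finset (Sym2 V) :=
    fun ω => ω.filter fun e => ∃ v ∈ openCluster (↑ω : BondConfig V) x, v ∈ e with hΦ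
  have hΦmem : ∀ ω e, e ∈ Φ ω ↔ e ∈ ω ∧ ∃ v ∈ openCluster (↑ω : BondConfig V) x, v ∈ e :=
    fun ω e => by simp only [hΦ, Finset.mem_filter]
  have hΦE : ∀ ω ∈ G.edgeFinset.powerset, Φ ω ∈ G.edgeFinset.powerset := fun ω hω =>
    Finset.mem_powerset.2 fun e he => Finset.mem_powerset.1 hω ((hΦmem ω e).1 he).1
  rw [rcMeasure_real_apply G hp' hq ∅, integral_rcMeasure G hp' hq ∅]
  refine ((Finset.sum_fiberwise_of_maps_to hΦE _).symm.trans ?_).trans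
    (Finset.sum_fiberwise_of_maps_to hΦE _)
  refine Finset.sum_congr rfl fun ζ _ => ?_
  -- the edges of `G` not touching the `ζ`-cluster of `x`
  obtain ⟨U, hU⟩ : ∃ U : Finset (Sym2 V), ∀ e, e ∈ U ↔
      e ∈ G.edgeFinset ∧ ∀ v ∈ openCluster (↑ζ : BondConfig V) x, v ∉ e :=
    ⟨G.edgeFinset.filter fun e => ∀ v ∈ openCluster (↑ζ : BondConfig V) x, v ∉ e,
      fun e => Finset.mem_filter⟩
  -- the fibre of `ζ` is the cylinder `{ω ∖ U = ζ}`
  have key : ∀ f : Finset (Sym2 V) → ℝ,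
      ∑ ω ∈ G.edgeFinset.powerset with Φ ω = ζ, f ω =
        ∑ ω ∈ G.edgeFinset.powerset, if (↑ω : Set (Sym2 V)) ∩ (↑U)ᶜ = ↑ζ then f ω else 0 := by
    intro f
    rw [Finset.sum_filter]
    refine Finset.sum_congr rfl fun ω hω => if_congr ?_ rfl rfl
    exact filter_touch_eq_iff (Finset.mem_powerset.1 hω) hU rfl (hΦmem ω)
  rw [key, key]
  exact fibre_eq G hp hq x x' y y' hyy' ζ hU rfl

end Summit.CriticalPhenomena.Ising3DConformalLimit.Cruxes.FKFourConnectivity.ClusterHoleOpacity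

end
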